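import Summits.Ventures.PercRepro.RankDistTightSplit

/-!
# PercRepro — the independent shadow of the tight layer is non-empty at every level, so ultra-log-concavity alone
gives its cumulative inequality (p9, gen 19)

A bottom set `B` is a bipartition `(B, E ∖ B)` into two independent sets, so `i_q ≠ 0` when `𝓑 ≠ ∅`; a bipartition
`(A, E ∖ A)` with `2|A| < p + q` augments (`Indep.augment`) to one with `|A| + 1` elements, so `i_u ≠ 0` up to the
middle, and by the symmetry `i_u = i_{p+q−u}` on the whole of `[q, p]` (`indepShadow_card_ne_zero`). Hence
(**`indepShadowCumulative_of_ulc'`**) ultra-log-concavity of `i_u` gives `IndepShadowCumulative M p q` with no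
positivity hypothesis (when `𝓑 = ∅` every level is empty and the inequality is `0 ≤ 0`). Nothing here is a statement
about any window of the crux.
-/

namespace PercRepro.RankDist

open Set Finset _root_.Matroid PercRepro.ThmH

variable {α : Type} [DecidableEq α] (M : Matroid α) [M.Finite]

/-- A bottom set is an independent shadow set of rank `q` (tight layer). -/
lemma coe_mem_indepShadow_of_mem_Uq {p q : ℕ} (hn : (gr M).card = p + q) (hr : M.eRank = (p : ℕ∞))
    {B : Finset α} (hB : B ∈ PerFlat.Uq M p q) : (B : Set α) ∈ indepShadow M p q q := by
  rw [mem_indepShadow_iff_tight M hn hr]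
  rw [mem_Uq_tight M hn hr] at hB
  obtain ⟨hBE, hBind, hBq, hD⟩ := hB
  have hDcoe : ((gr M \ B : Finset α) : Set α) = M.E \ B := by rw [Finset.coe_sdiff, coe_gr]
  refine ⟨?_, ?_, hBind, ?_⟩
  · rw [← coe_gr]; exact_mod_cast hBE
  · rw [Set.ncard_coe_finset, hBq]
  · rw [← hDcoe]; exact hD.indep

/-- Below the middle an independent shadow set augments by one element. -/
lemma exists_mem_indepShadow_succ {p q u : ℕ} (hn : (gr M).card = p + q) (hr : M.eRank = (p : ℕ∞))
    (hu : 2 * u < p + q) {A : Set α} (hA : A ∈ indepShadow M p q u) :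
    ∃ A', A' ∈ indepShadow M p q (u + 1) := by
  rw [mem_indepShadow_iff_tight M hn hr] at hA
  obtain ⟨hAE, hAu, hAind, hcompl⟩ := hA
  have hfinA : A.Finite := M.ground_finite.subset hAE
  have hEcard : M.E.ncard = p + q := by rw [← card_gr, hn]
  have hlt : A.encard < (M.E \ A).encard := by
    rw [← hfinA.cast_ncard_eq, ← (M.ground_finite.sdiff).cast_ncard_eq, Set.ncard_sdiff hAE hfinA, hEcard, hAu]
    exact_mod_cast (by omega : u < p + q - u)
  obtain ⟨e, he, heA⟩ := hAind.augment hcompl hlt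
  -- `e ∈ (E ∖ A) ∖ A`: in `E`, not in `A`
  have heE : e ∈ M.E := he.1.1
  have heA' : e ∉ A := he.2
  refine ⟨insert e A, ?_⟩
  rw [mem_indepShadow_iff_tight M hn hr]
  refine ⟨Set.insert_subset heE hAE, ?_, heA, ?_⟩
  · rw [Set.ncard_insert_of_notMem heA' hfinA, hAu]
  · have h1 : M.E \ insert e A ⊆ M.E \ A := Set.sdiff_subset_sdiff_right (Set.subset_insert _ _)
    exact hcompl.subset h1

/-- **The independent shadow is non-empty at every level of `[q, p]` when there is a bottom set** (tight layer). -/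
theorem indepShadow_card_ne_zero {p q : ℕ} (hn : (gr M).card = p + q) (hr : M.eRank = (p : ℕ∞))
    (hB : (PerFlat.Uq M p q).Nonempty) : ∀ u, q ≤ u → u ≤ p → (indepShadow M p q u).card ≠ 0 := by
  -- up to the middle by augmentation
  have hhalf : ∀ u, q ≤ u → 2 * u ≤ p + q → (indepShadow M p q u).Nonempty := by
    intro u hqu
    induction u, hqu using Nat.le_induction with
    | base =>
      intro _
      obtain ⟨B, hB⟩ := hB
      exact ⟨(B : Set α), coe_mem_indepShadow_of_mem_Uq M hn hr hB⟩
    | succ v hqv ih =>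
      intro hv
      obtain ⟨A, hA⟩ := ih (by omega)
      exact exists_mem_indepShadow_succ M hn hr (by omega) hA
  intro u hqu hup
  by_cases hmid : 2 * u ≤ p + q
  · exact Finset.card_ne_zero.2 (hhalf u hqu hmid)
  · rw [card_indepShadow_symm M hn hr (by omega)]
    exact Finset.card_ne_zero.2 (hhalf (p + q - u) (by omega) (by omega))

/-- **Ultra-log-concavity of the independent shadow gives its cumulative inequality** (tight layer), with no
positivity hypothesis. -/
theorem indepShadowCumulative_of_ulc' {p q : ℕ} (hn : (gr M).card = p + q) (hr : M.eRank = (p : ℕ∞))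
    (hqp : q ≤ p)
    (hulc : ∀ u, q < u → u < p →
      (indepShadow M p q (u - 1)).card * (indepShadow M p q (u + 1)).card * ((p + q).choose u) ^ 2
        ≤ (indepShadow M p q u).card * (indepShadow M p q u).card
          * ((p + q).choose (u - 1) * (p + q).choose (u + 1))) :
    IndepShadowCumulative M p q := by
  by_cases hB : (PerFlat.Uq M p q).Nonempty
  · exact indepShadowCumulative_of_ulc M hn hr hqp (indepShadow_card_ne_zero M hn hr hB) hulc
  · -- no bottom set: every level is empty
    rw [Finset.not_nonempty_iff_eq_empty] at hB
    have hempty : ∀ u, indepShadow M p q u = ∅ := by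
      intro u
      rw [Finset.eq_empty_iff_forall_notMem]
      intro A hA
      have hA' := ((mem_indepShadow M).1 hA).1
      rw [mem_shadowLev] at hA'
      obtain ⟨-, -, B', hB', -⟩ := hA'
      rw [hB] at hB'
      exact Finset.notMem_empty _ hB'
    intro u _ _
    rw [hempty q, hempty u, Finset.card_empty, zero_mul, zero_mul]

end PercRepro.RankDist
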